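import Literature.MathematicalPhysics.QuantumFieldTheory.Balaban1983to89.B9Thm31GpDecayOfCoerciveZd

/-!
# `Balaban1983to89.B9Eq323ConjugatedLaplacianFormZd` — [Balaban1985BackgroundPropagators] (3.23) p. 394 (`Δ^η_U = Σ_μ D^{η*}_{U,μ}D^η_{U,μ}`) ∕ Thm 3.1 (3.42),
# (3.46) pp. 397–398: THE CONJUGATED GRADIENT FORM OF THE COVARIANT LAPLACIAN AT THE `ℤᵈ` CARRIER — for a positive site weight `ω`, a unitary background
# `U₀` and a tracial Hermitian faithful `τ`, `Σ_μ Σ_x Re τ((D^η_{U₀,μ}(ωΦ))(x)* (D^η_{U₀,μ}(ω⁻¹Φ))(x)) ≥ Σ_μ Σ_x |(D^η_{U₀,μ}Φ)(x)|²_τ − Σ_z J_b(z)|Φ(z)|²_τ`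
# with the defect `J_b(z) = η⁻²Σ_μ(5∕2·r_ω(z − e_μ, μ) + 1∕2·r_ω(z, μ))` EXACTLY QUADRATIC in the bond ratios `r_ω(x, μ) = (ω(x+e_μ) − ω(x))²∕(ω(x)ω(x+e_μ))`

statement-level skeleton of published theorems with citation tags; proofs where landed; nothing here is a claim about the
Yang–Mills mass gap

`[Balaban1985BackgroundPropagators]` ("B9", CMP **99** (1985) 389–434): (3.23) p. 394 *«Δ^η_U = D^{η*}_U D^η_U = Σ_μ D^{η*}_{U,μ}D^η_{U,μ}»*; Thm 3.1 p. 397 with (3.42),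
(3.46) p. 398 (*«uniformly in U, Ω_j»*); [Balaban1985RegularSpaces] (1.1) p. 76 (`D^η_{U,μ}`).  Print obtains the decay by the random walk of Sects. B–C.  The
route's Agmon ∕ form-relative reading (this seat g5, `B9Eq346AgmonReadingZd`) needs the CONJUGATED form `⟨ωΦ, Δ′_a(U₀)(ω⁻¹Φ)⟩_τ` bounded below by the form
itself minus a defect measured against level masses; THIS FILE supplies the Laplacian half of that defect, and the point of the computation is that it is
EXACTLY QUADRATIC in the relative bond increments of `ω` (the coefficient of the cross term `Re τ((D_μΦ)* R(U₀)Φ(x+e_μ))` in the expansion of the conjugated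
product is `ω_xβ + αω_x⁻¹ = η⁻¹(ω(x+e_μ) − ω(x))²∕(ω(x)ω(x+e_μ))`, not of first order): a weight of slope `κL^{−j}` per fine bond costs `κ²(Lʲη)⁻²` per site —
the scale of print's level masses — so that the rate window of the assembly file is free of the lattice spacing.  (The Schur window of this seat's g4 files
`B9Thm31GpDecayOfCoerciveZd ∕ …PlaqClosedZd`, linear in `e^{κr} − 1` against the matrix entries `4d∕η²`, was not.)  The mechanism is the one dag-n06-w1 g2 typed at
def-Y's record carrier (`B9Thm31SiteConjugatedFormY`); here it is typed for the junction carrier's own letters (`B8Ineq132.covDerivFwd`, `conjR`, the fibre size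
`fnorm τ`), nothing of theirs restated.

CITATION HEADER (lean-in-tree rule).  Cell `pub-ymgap` (YM Track A, HUMAN RULING D-0062 ∕ D-0149 width push), DAG node N06 = [B9], width seat
`pub-ymgap-dag-n06-w2` (g5), CLAIM-2 FILE 2a («Agmon ∕ form-relative edition of the Combes–Thomas road at the ℤᵈ frame»).  Inputs BY NAME: `covDerivFwd` ([B8] seat),
`conjR ∕ conjR_smul_real` (`B7Eq78Linearization`), `suppSub` (dag-n06-w4 g0), `fibreForm_comm` (dag-n06-w4 g2), the engine's `fnorm ∕ fnorm_smul ∕ fnorm_sq ∕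
abs_fibreForm_le` and `fnorm_conjR_of_unitary ∕ fnorm_sub_le` (this seat g4).

WHAT IS DECLARED ∕ PROVED (kernel, 0 sorry; one small definition with body + theorems; no `instance`, no `notation`).
* §1 fibre algebra: `re_trace_pair_expand` (`Re τ((pA + αC)* (qA + βC)) = pq·Re τ(A*A) + (pβ + αq)·Re τ(A*C) + αβ·Re τ(C*C)`, Hermitian `τ`), ★ `bondRatio ω x μ`
  (`:= (ω(x+e_μ) − ω(x))²∕(ω(x)ω(x+e_μ))`), `bondRatio_nonneg`, `weight_coeffs` (the two coefficient identities `ω_xβ + αω_x⁻¹ = η⁻¹r`, `αβ = −η⁻²r`).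
* §2 ★ `covDerivFwd_scale` — `D^η_{U₀,μ}(ωF)(x) = ω(x)·(D^η_{U₀,μ}F)(x) + η⁻¹(ω(x+e_μ) − ω(x))·R(U₀(x,μ))F(x+e_μ)` (the conjugation defect of one covariant bond
  difference; any units `U₀`); `fnorm_covDerivFwd_le` (`|(D_μF)(x)|_τ ≤ |η|⁻¹(|F(x+e_μ)|_τ + |F(x)|_τ)`, unitary `U₀`).
* §3 ★★ `re_trace_conj_covDerivFwd_ge` — THE POINTWISE BOUND: `Re τ((D_μ(ωF))(x)* (D_μ(ω⁻¹F))(x)) ≥ |(D_μF)(x)|²_τ − η⁻²·r_ω(x,μ)·(5∕2·|F(x+e_μ)|²_τ + 1∕2·|F(x)|²_τ)`.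
* §4 bookkeeping on `L²(Ω₀, ·)`: `covDerivFwd_eq_zero_off` (a field supported in `Ω₀` has `D_μ` supported in `Ω₀ ∪ (Ω₀ − e_μ)`), `finsum_pair_covDerivFwd_eq_sum`,
  and ★★★ `sum_finsum_conj_covDerivFwd_ge` — THE SUMMED BOUND for `Φ ∈ L²(Ω₀, ·)`:
  `Σ_μ Σᶠ_x Re τ((D_μ(ωΦ))(x)* (D_μ(ω⁻¹Φ))(x)) ≥ Σ_μ Σᶠ_x Re τ((D_μΦ)(x)* (D_μΦ)(x)) − Σ_{z∈Ω₀} J_b(z)·|Φ(z)|²_τ`,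
  `J_b(z) := η⁻²·Σ_μ (5∕2·r_ω(z − e_μ, μ) + 1∕2·r_ω(z, μ))` — the first summand of `formE_deltaPrimeADom`'s right-hand side, conjugated.

HONEST SCOPE.  [folklore] one-bond algebra and Cauchy–Schwarz in the fibre; NO estimate of [B9] is proved — this is the Laplacian half of a conjugation-defect
bound whose other half (the averaging penalty `Σ_j a_jQ′_jᵀQ′_j`) and whose use (Agmon readings against a DISPLAYED level-weighted coercivity) are the sequel files
`B9Eq324ConjugatedFormZd` ∕ `B9Thm31GpAgmonDecayZd`; constants `5∕2, 1∕2` are crude.  Count-neutral; N05 ∕ N06 NOT discharged; K1⁹ `stmt-QuantumFields-27364` NOT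
closed; one finite `𝕋⁴` programme at fixed `ε`, Bałaban as printed; R4 closes only the conditional finite-`𝕋⁴` rung `BalabanLadder.UV` — nothing continuum ∕ ℝ⁴ ∕
OS ∕ mass gap ∕ Clay.  Unit `pub-ymgap-dag-n06-w2` (g5), 2026-08-28.
-/

noncomputable section

open scoped BigOperators

namespace Literature.MathematicalPhysics.QuantumFieldTheory.Balaban1983to89.B9Eq323ConjugatedLaplacianFormZd

open B7Prop1Explicit (e)
open B7Eq78Linearization (conjR conjR_apply conjR_smul_real)
open B7Prop2Explicit (unitaryUnits)
open B8Ineq132 (covDerivFwd)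
open B9Eq321LandauProjectionZd (suppSub)
open B9Eq324DeltaPrimeAZd (fibreForm fibreForm_apply fibreForm_comm)
open B9Eq342CombesThomasFormZd
open B9Thm31GpDecayOfCoerciveZd (fnorm_conjR_of_unitary fnorm_sub_le)

export B7Prop1Explicit (Site)

variable {d : ℕ} {𝔸 : Type*} [CStarAlgebra 𝔸] (τ : 𝔸 →ₗ[ℂ] ℂ)

/-! ## §1  Fibre algebra: the expansion of a conjugated product; the bond ratio of a weight -/

section Fibre

/-- `Re τ((c•a)* b) = c·Re τ(a* b)`, real `c`. [folklore] [cite: Balaban1985BackgroundPropagators, p.391 («natural L² scalar products»; bookkeeping)] -/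
private theorem re_smul_left (c : ℝ) (a b : 𝔸) : (τ (star (c • a) * b)).re = c * (τ (star a * b)).re := by
  rw [star_smul, star_trivial, smul_mul_assoc, ← Complex.coe_smul, map_smul, smul_eq_mul, Complex.re_ofReal_mul]

/-- `Re τ(a* (c•b)) = c·Re τ(a* b)`, real `c`. [folklore] [cite: Balaban1985BackgroundPropagators, p.391 («natural L² scalar products»; bookkeeping)] -/
private theorem re_smul_right (c : ℝ) (a b : 𝔸) : (τ (star a * (c • b))).re = c * (τ (star a * b)).re := by
  rw [mul_smul_comm, ← Complex.coe_smul, map_smul, smul_eq_mul, Complex.re_ofReal_mul]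

/-- **EXPANSION OF A CONJUGATED PRODUCT** (Hermitian `τ`): `Re τ((pA + αC)* (qA + βC)) = pq·Re τ(A*A) + (pβ + αq)·Re τ(A*C) + αβ·Re τ(C*C)`.
[folklore] [cite: Balaban1985BackgroundPropagators, (3.23) p.394 (bookkeeping for the conjugated form)] -/
theorem re_trace_pair_expand (hτs : ∀ a : 𝔸, τ (star a) = starRingEnd ℂ (τ a)) (A C : 𝔸) (p q α β : ℝ) :
    (τ (star (p • A + α • C) * (q • A + β • C))).re =
      p * q * (τ (star A * A)).re + (p * β + α * q) * (τ (star A * C)).re + α * β * (τ (star C * C)).re := by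
  have hsymm : (τ (star C * A)).re = (τ (star A * C)).re := by
    rw [← fibreForm_apply, fibreForm_comm τ hτs, fibreForm_apply]
  simp only [star_add, add_mul, mul_add, map_add, Complex.add_re, re_smul_left, re_smul_right, hsymm]
  ring

/-- ★ **THE BOND RATIO OF A WEIGHT**: `r_ω(x, μ) := (ω(x+e_μ) − ω(x))²∕(ω(x)·ω(x+e_μ))` — the size of the conjugation defect of one covariant bond difference
(for `ω = e^{κρ}`: `2(cosh(κ(ρ(x+e_μ) − ρ(x))) − 1)`). [cite: Balaban1985BackgroundPropagators, (3.42) p.397 (the weight `e^{−δ₀d}`); Agmon1982, Thm 1.5 p.19] -/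
def bondRatio (ω : Site d → ℝ) (x : Site d) (μ : Fin d) : ℝ := (ω (x + e μ) - ω x) ^ 2 / (ω x * ω (x + e μ))

omit [CStarAlgebra 𝔸] in
/-- `bondRatio`, unfolded. [cite: Balaban1985BackgroundPropagators, (3.42) p.397 (bookkeeping)] -/
theorem bondRatio_def (ω : Site d → ℝ) (x : Site d) (μ : Fin d) : bondRatio ω x μ = (ω (x + e μ) - ω x) ^ 2 / (ω x * ω (x + e μ)) := rfl

omit [CStarAlgebra 𝔸] in
/-- `0 ≤ r_ω(x, μ)` for a positive weight. [cite: Balaban1985BackgroundPropagators, (3.42) p.397 (bookkeeping)] -/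
theorem bondRatio_nonneg {ω : Site d → ℝ} (hω : ∀ z, 0 < ω z) (x : Site d) (μ : Fin d) : 0 ≤ bondRatio ω x μ :=
  div_nonneg (sq_nonneg _) (mul_pos (hω x) (hω (x + e μ))).le

omit [CStarAlgebra 𝔸] in
/-- **THE TWO COEFFICIENT IDENTITIES**: with `α = η⁻¹(ω₁ − ω₀)`, `β = η⁻¹(ω₁⁻¹ − ω₀⁻¹)` (`ω₀ = ω(x)`, `ω₁ = ω(x+e_μ)`, both nonzero),
`ω₀β + αω₀⁻¹ = η⁻¹·(ω₁ − ω₀)²∕(ω₀ω₁)` and `αβ = −η⁻²·(ω₁ − ω₀)²∕(ω₀ω₁)` — the cross term of the conjugated product is of SECOND order in the increment.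
[folklore] [cite: Balaban1985BackgroundPropagators, (3.42) p.397; Agmon1982, Thm 1.5 p.19 (the positive-weight identity)] -/
theorem weight_coeffs {ω₀ ω₁ η : ℝ} (h0 : ω₀ ≠ 0) (h1 : ω₁ ≠ 0) :
    ω₀ * (η⁻¹ * (ω₁⁻¹ - ω₀⁻¹)) + η⁻¹ * (ω₁ - ω₀) * ω₀⁻¹ = η⁻¹ * ((ω₁ - ω₀) ^ 2 / (ω₀ * ω₁)) ∧
      η⁻¹ * (ω₁ - ω₀) * (η⁻¹ * (ω₁⁻¹ - ω₀⁻¹)) = -((η⁻¹) ^ 2 * ((ω₁ - ω₀) ^ 2 / (ω₀ * ω₁))) := by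
  constructor
  · field_simp
    ring
  · field_simp
    ring

end Fibre

/-! ## §2  The conjugation defect of one covariant bond difference -/

section Bond

variable {η : ℝ} {U₀ : Site d → Fin d → 𝔸ˣ}

omit τ in
/-- ★ **`D^η_{U₀,μ}(ωF)(x) = ω(x)·(D^η_{U₀,μ}F)(x) + η⁻¹(ω(x+e_μ) − ω(x))·R(U₀(x,μ))F(x+e_μ)`** for a real site weight `ω` (any units `U₀`; `R(u)` is ℝ-linear).
[cite: Balaban1985RegularSpaces, (1.1) p.76; Balaban1985BackgroundPropagators, (3.23) p.394] -/
theorem covDerivFwd_scale (η : ℝ) (U₀ : Site d → Fin d → 𝔸ˣ) (μ : Fin d) (ω : Site d → ℝ) (F : Site d → 𝔸) (x : Site d) :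
    covDerivFwd η U₀ μ (fun z => ω z • F z) x =
      ω x • covDerivFwd η U₀ μ F x + (η⁻¹ * (ω (x + e μ) - ω x)) • conjR (U₀ x μ) (F (x + e μ)) := by
  simp only [covDerivFwd, conjR_smul_real, smul_sub, smul_smul]
  module

/-- **`|(D^η_{U₀,μ}F)(x)|_τ ≤ |η|⁻¹·(|F(x+e_μ)|_τ + |F(x)|_τ)`** at a unitary background (`|R(u)a|_τ = |a|_τ`).
[cite: Balaban1985RegularSpaces, (1.1) p.76; Balaban1985BackgroundPropagators, (3.28) p.395] -/
theorem fnorm_covDerivFwd_le (hτp : ∀ a : 𝔸, a ≠ 0 → 0 < (τ (star a * a)).re) (hτt : ∀ a b : 𝔸, τ (a * b) = τ (b * a))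
    (hτs : ∀ a : 𝔸, τ (star a) = starRingEnd ℂ (τ a)) (hU : ∀ (x : Site d) (κ : Fin d), U₀ x κ ∈ unitaryUnits 𝔸) (F : Site d → 𝔸) (μ : Fin d) (x : Site d) :
    fnorm τ (covDerivFwd η U₀ μ F x) ≤ |η|⁻¹ * (fnorm τ (F (x + e μ)) + fnorm τ (F x)) := by
  rw [covDerivFwd, fnorm_smul, abs_inv]
  refine mul_le_mul_of_nonneg_left ?_ (inv_nonneg.2 (abs_nonneg η))
  exact (fnorm_sub_le τ hτp hτs _ _).trans (by rw [fnorm_conjR_of_unitary τ hτt (hU x μ)])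

end Bond

/-! ## §3  The pointwise lower bound for the conjugated product of one bond -/

section Pointwise

variable {η : ℝ} {U₀ : Site d → Fin d → 𝔸ˣ}

/-- ★★ **THE POINTWISE BOUND.**  For `ω > 0`, unitary `U₀`, tracial Hermitian faithful `τ`, every site function `F`, direction `μ` and site `x`:
`Re τ((D_μ(ωF))(x)* (D_μ(ω⁻¹F))(x)) ≥ |(D_μF)(x)|²_τ − η⁻²·r_ω(x,μ)·(5∕2·|F(x+e_μ)|²_τ + 1∕2·|F(x)|²_τ)`.  PROOF: by `covDerivFwd_scale` the two factors are
`ω_xA + αC` and `ω_x⁻¹A + βC` with `A = (D_μF)(x)`, `C = R(U₀(x,μ))F(x+e_μ)`; the expansion has cross coefficient `η⁻¹r` and `C*C` coefficient `−η⁻²r`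
(`weight_coeffs`), and `|Re τ(A*C)| ≤ |A||C| ≤ |η|⁻¹(|C| + |F(x)|)|C|` with `|C| = |F(x+e_μ)|`.
[cite: Balaban1985BackgroundPropagators, (3.23) p.394, (3.42) p.397; Agmon1982, Thm 1.5 p.19] -/
theorem re_trace_conj_covDerivFwd_ge (hτp : ∀ a : 𝔸, a ≠ 0 → 0 < (τ (star a * a)).re) (hτt : ∀ a b : 𝔸, τ (a * b) = τ (b * a))
    (hτs : ∀ a : 𝔸, τ (star a) = starRingEnd ℂ (τ a)) (hU : ∀ (x : Site d) (κ : Fin d), U₀ x κ ∈ unitaryUnits 𝔸)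
    {ω : Site d → ℝ} (hω : ∀ z, 0 < ω z) (F : Site d → 𝔸) (μ : Fin d) (x : Site d) :
    (τ (star (covDerivFwd η U₀ μ F x) * covDerivFwd η U₀ μ F x)).re -
        (η⁻¹) ^ 2 * bondRatio ω x μ * (5 / 2 * fnorm τ (F (x + e μ)) ^ 2 + 1 / 2 * fnorm τ (F x) ^ 2) ≤
      (τ (star (covDerivFwd η U₀ μ (fun z => ω z • F z) x) * covDerivFwd η U₀ μ (fun z => (ω z)⁻¹ • F z) x)).re := by
  set A : 𝔸 := covDerivFwd η U₀ μ F x with hA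
  set C : 𝔸 := conjR (U₀ x μ) (F (x + e μ)) with hC
  set ω₀ : ℝ := ω x with hω₀
  set ω₁ : ℝ := ω (x + e μ) with hω₁
  have h0 : ω₀ ≠ 0 := (hω x).ne'
  have h1 : ω₁ ≠ 0 := (hω (x + e μ)).ne'
  set r : ℝ := bondRatio ω x μ with hr
  have hrdef : r = (ω₁ - ω₀) ^ 2 / (ω₀ * ω₁) := rfl
  -- the two conjugated bond differences
  have hplus : covDerivFwd η U₀ μ (fun z => ω z • F z) x = ω₀ • A + (η⁻¹ * (ω₁ - ω₀)) • C := covDerivFwd_scale η U₀ μ ω F x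
  have hminus : covDerivFwd η U₀ μ (fun z => (ω z)⁻¹ • F z) x = ω₀⁻¹ • A + (η⁻¹ * (ω₁⁻¹ - ω₀⁻¹)) • C :=
    covDerivFwd_scale η U₀ μ (fun z => (ω z)⁻¹) F x
  rw [hplus, hminus, re_trace_pair_expand τ hτs A C ω₀ ω₀⁻¹ (η⁻¹ * (ω₁ - ω₀)) (η⁻¹ * (ω₁⁻¹ - ω₀⁻¹)), mul_inv_cancel₀ h0, one_mul]
  obtain ⟨hcross, hsq⟩ := weight_coeffs (η := η) h0 h1
  rw [hcross, hsq, ← hrdef]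
  -- sizes
  have hCn : fnorm τ C = fnorm τ (F (x + e μ)) := fnorm_conjR_of_unitary τ hτt (hU x μ) _
  have hAC : |(τ (star A * C)).re| ≤ fnorm τ A * fnorm τ C := abs_fibreForm_le hτp hτs A C
  have hAle : fnorm τ A ≤ |η|⁻¹ * (fnorm τ (F (x + e μ)) + fnorm τ (F x)) := fnorm_covDerivFwd_le τ hτp hτt hτs hU F μ x
  have hCC : (τ (star C * C)).re = fnorm τ (F (x + e μ)) ^ 2 := by rw [← hCn]; exact (fnorm_sq hτp C).symm
  rw [hCC]
  have hr0 : 0 ≤ r := bondRatio_nonneg hω x μ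
  have hF1 := fnorm_nonneg τ (F (x + e μ))
  have hF0 := fnorm_nonneg τ (F x)
  have hA0 := fnorm_nonneg τ A
  have hηabs : |η|⁻¹ ^ 2 = (η⁻¹) ^ 2 := by rw [inv_pow, sq_abs, inv_pow]
  have hηi : 0 ≤ |η|⁻¹ := inv_nonneg.2 (abs_nonneg η)
  -- the cross term: `η⁻¹ r Re τ(A*C) ≥ −|η|⁻¹ r |A||C| ≥ −η⁻² r (|F₁| + |F₀|)|F₁|`
  have hcross_bd : -((η⁻¹) ^ 2 * r * ((fnorm τ (F (x + e μ)) + fnorm τ (F x)) * fnorm τ (F (x + e μ)))) ≤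
      η⁻¹ * r * (τ (star A * C)).re := by
    have h1' : |η⁻¹ * r * (τ (star A * C)).re| ≤ |η|⁻¹ * r * (fnorm τ A * fnorm τ C) := by
      rw [abs_mul, abs_mul, abs_inv, abs_of_nonneg hr0]
      exact mul_le_mul_of_nonneg_left hAC (mul_nonneg hηi hr0)
    have h2' : |η|⁻¹ * r * (fnorm τ A * fnorm τ C) ≤ |η|⁻¹ * r * (|η|⁻¹ * (fnorm τ (F (x + e μ)) + fnorm τ (F x)) * fnorm τ (F (x + e μ))) := by
      rw [hCn]
      exact mul_le_mul_of_nonneg_left (mul_le_mul_of_nonneg_right hAle hF1) (mul_nonneg hηi hr0)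
    have h3 : |η|⁻¹ * r * (|η|⁻¹ * (fnorm τ (F (x + e μ)) + fnorm τ (F x)) * fnorm τ (F (x + e μ))) =
        (η⁻¹) ^ 2 * r * ((fnorm τ (F (x + e μ)) + fnorm τ (F x)) * fnorm τ (F (x + e μ))) := by rw [← hηabs]; ring
    have := neg_abs_le (η⁻¹ * r * (τ (star A * C)).re)
    linarith
  -- Young: `(|F₁| + |F₀|)|F₁| ≤ 3∕2|F₁|² + 1∕2|F₀|²`
  have hyoung : (fnorm τ (F (x + e μ)) + fnorm τ (F x)) * fnorm τ (F (x + e μ)) ≤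
      3 / 2 * fnorm τ (F (x + e μ)) ^ 2 + 1 / 2 * fnorm τ (F x) ^ 2 := by
    nlinarith [sq_nonneg (fnorm τ (F (x + e μ)) - fnorm τ (F x))]
  have hη2r : 0 ≤ (η⁻¹) ^ 2 * r := mul_nonneg (sq_nonneg _) hr0
  nlinarith [mul_le_mul_of_nonneg_left hyoung hη2r, hcross_bd]

end Pointwise

/-! ## §4  The summed bound on `L²(Ω₀, ·)` -/

section Summed

variable {η : ℝ} {U₀ : Site d → Fin d → 𝔸ˣ} {s : Finset (Site d)}

omit τ in
/-- a field supported in `Ω₀` has `D_μ` supported in `Ω₀ ∪ (Ω₀ − e_μ)`: off that set both `F(x)` and `F(x+e_μ)` vanish.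
[cite: Balaban1985RegularSpaces, (1.1) p.76 (bookkeeping)] -/
theorem covDerivFwd_eq_zero_off (μ : Fin d) {F : Site d → 𝔸} (hF : ∀ z, z ∉ s → F z = 0) {x : Site d}
    (hx : x ∉ s ∪ s.image (fun z => z - e μ)) : covDerivFwd η U₀ μ F x = 0 := by
  rw [Finset.mem_union, not_or] at hx
  have h0 : F x = 0 := hF x hx.1
  have h1 : F (x + e μ) = 0 := by
    refine hF _ fun hmem => hx.2 ?_
    exact Finset.mem_image.2 ⟨x + e μ, hmem, add_sub_cancel_right x (e μ)⟩
  rw [covDerivFwd, h0, h1, conjR_apply, mul_zero, zero_mul, sub_zero, smul_zero]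

/-- a `finsum` pairing whose right factor is `D_μ` of a field supported in `Ω₀` is the sum over `Ω₀ ∪ (Ω₀ − e_μ)`.
[cite: Balaban1985BackgroundPropagators, (3.23) p.394 (bookkeeping)] -/
theorem finsum_pair_covDerivFwd_eq_sum (μ : Fin d) (G : Site d → 𝔸) {F : Site d → 𝔸} (hF : ∀ z, z ∉ s → F z = 0) :
    ∑ᶠ x, (τ (star (G x) * covDerivFwd η U₀ μ F x)).re =
      ∑ x ∈ s ∪ s.image (fun z => z - e μ), (τ (star (G x) * covDerivFwd η U₀ μ F x)).re := by
  classical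
  refine finsum_eq_sum_of_support_subset _ fun x hx => ?_
  rw [Function.mem_support] at hx
  rw [Finset.mem_coe]
  by_contra hxs
  exact hx (by rw [covDerivFwd_eq_zero_off μ hF hxs, mul_zero, map_zero, Complex.zero_re])

/-- ★★★ **THE SUMMED BOUND.**  For `Φ ∈ L²(Ω₀, ·)`, `ω > 0`, unitary `U₀`, tracial Hermitian faithful `τ`:
`Σ_μ Σᶠ_x Re τ((D_μΦ)(x)* (D_μΦ)(x)) − Σ_{z∈Ω₀} J_b(z)·|Φ(z)|²_τ ≤ Σ_μ Σᶠ_x Re τ((D_μ(ωΦ))(x)* (D_μ(ω⁻¹Φ))(x))` with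
`J_b(z) = η⁻²·Σ_μ (5∕2·r_ω(z − e_μ, μ) + 1∕2·r_ω(z, μ))` — the gradient part of `⟨ωΦ, Δ′_a(U₀)(ω⁻¹Φ)⟩_τ` (first summand of
`B9Eq324DeltaPrimeAZd.formE_deltaPrimeADom` at `g = ωΦ`, `f = ω⁻¹Φ`) is the gradient energy of `Φ` up to a defect QUADRATIC in the bond ratios of `ω`.
[cite: Balaban1985BackgroundPropagators, (3.23) p.394, Thm 3.1 (3.42) p.397, (3.46) p.398; Agmon1982, Thm 1.5 p.19] -/
theorem sum_finsum_conj_covDerivFwd_ge (hτp : ∀ a : 𝔸, a ≠ 0 → 0 < (τ (star a * a)).re) (hτt : ∀ a b : 𝔸, τ (a * b) = τ (b * a))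
    (hτs : ∀ a : 𝔸, τ (star a) = starRingEnd ℂ (τ a)) (hU : ∀ (x : Site d) (κ : Fin d), U₀ x κ ∈ unitaryUnits 𝔸)
    {ω : Site d → ℝ} (hω : ∀ z, 0 < ω z) (Φ : suppSub (𝔸 := 𝔸) s) :
    (∑ μ : Fin d, ∑ᶠ x, (τ (star (covDerivFwd η U₀ μ (Φ : Site d → 𝔸) x) * covDerivFwd η U₀ μ (Φ : Site d → 𝔸) x)).re) -
        ∑ z ∈ s, ((η⁻¹) ^ 2 * ∑ μ : Fin d, (5 / 2 * bondRatio ω (z - e μ) μ + 1 / 2 * bondRatio ω z μ)) * fnorm τ ((Φ : Site d → 𝔸) z) ^ 2 ≤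
      ∑ μ : Fin d, ∑ᶠ x, (τ (star (covDerivFwd η U₀ μ (fun z => ω z • (Φ : Site d → 𝔸) z) x) *
        covDerivFwd η U₀ μ (fun z => (ω z)⁻¹ • (Φ : Site d → 𝔸) z) x)).re := by
  classical
  set F : Site d → 𝔸 := (Φ : Site d → 𝔸) with hF
  have hFs : ∀ z, z ∉ s → F z = 0 := fun z hz => Φ.2 z hz
  have hωFs : ∀ z, z ∉ s → (fun z => ω z • F z) z = 0 := fun z hz => by simp only [hFs z hz, smul_zero]
  have hωiFs : ∀ z, z ∉ s → (fun z => (ω z)⁻¹ • F z) z = 0 := fun z hz => by simp only [hFs z hz, smul_zero]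
  -- the defect, reorganised per direction
  have hdefect : ∑ z ∈ s, ((η⁻¹) ^ 2 * ∑ μ : Fin d, (5 / 2 * bondRatio ω (z - e μ) μ + 1 / 2 * bondRatio ω z μ)) * fnorm τ (F z) ^ 2 =
      ∑ μ : Fin d, ∑ z ∈ s, (η⁻¹) ^ 2 * (5 / 2 * bondRatio ω (z - e μ) μ + 1 / 2 * bondRatio ω z μ) * fnorm τ (F z) ^ 2 := by
    rw [Finset.sum_comm]
    refine Finset.sum_congr rfl fun z _ => ?_
    rw [Finset.mul_sum, Finset.sum_mul]
  rw [hdefect, ← Finset.sum_sub_distrib]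
  refine Finset.sum_le_sum fun μ _ => ?_
  -- one direction: pass to the finite set `S = Ω₀ ∪ (Ω₀ − e_μ)`
  set S : Finset (Site d) := s ∪ s.image (fun z => z - e μ) with hS
  rw [finsum_pair_covDerivFwd_eq_sum τ μ _ hFs, finsum_pair_covDerivFwd_eq_sum τ μ _ hωiFs]
  -- the defect over `s` equals the pointwise defect summed over `S`
  have hsS : s ⊆ S := Finset.subset_union_left
  have hK : ∑ z ∈ s, (η⁻¹) ^ 2 * (5 / 2 * bondRatio ω (z - e μ) μ + 1 / 2 * bondRatio ω z μ) * fnorm τ (F z) ^ 2 =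
      ∑ x ∈ S, (η⁻¹) ^ 2 * bondRatio ω x μ * (5 / 2 * fnorm τ (F (x + e μ)) ^ 2 + 1 / 2 * fnorm τ (F x) ^ 2) := by
    -- split both sides
    have hL : ∑ z ∈ s, (η⁻¹) ^ 2 * (5 / 2 * bondRatio ω (z - e μ) μ + 1 / 2 * bondRatio ω z μ) * fnorm τ (F z) ^ 2 =
        (∑ z ∈ s, (η⁻¹) ^ 2 * bondRatio ω (z - e μ) μ * (5 / 2 * fnorm τ (F z) ^ 2)) +
          ∑ z ∈ s, (η⁻¹) ^ 2 * bondRatio ω z μ * (1 / 2 * fnorm τ (F z) ^ 2) := by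
      rw [← Finset.sum_add_distrib]
      exact Finset.sum_congr rfl fun z _ => by ring
    have hR : ∑ x ∈ S, (η⁻¹) ^ 2 * bondRatio ω x μ * (5 / 2 * fnorm τ (F (x + e μ)) ^ 2 + 1 / 2 * fnorm τ (F x) ^ 2) =
        (∑ x ∈ S, (η⁻¹) ^ 2 * bondRatio ω x μ * (5 / 2 * fnorm τ (F (x + e μ)) ^ 2)) +
          ∑ x ∈ S, (η⁻¹) ^ 2 * bondRatio ω x μ * (1 / 2 * fnorm τ (F x) ^ 2) := by
      rw [← Finset.sum_add_distrib]
      exact Finset.sum_congr rfl fun x _ => by ring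
    rw [hL, hR]
    congr 1
    · -- the shifted part: reindex `x = z − e_μ` over the image
      have himg : ∑ x ∈ s.image (fun z => z - e μ), (η⁻¹) ^ 2 * bondRatio ω x μ * (5 / 2 * fnorm τ (F (x + e μ)) ^ 2) =
          ∑ z ∈ s, (η⁻¹) ^ 2 * bondRatio ω (z - e μ) μ * (5 / 2 * fnorm τ (F z) ^ 2) := by
        have hinj : Set.InjOn (fun z : Site d => z - e μ) (↑s : Set (Site d)) := by
          intro z _ z' _ h
          simpa using h
        rw [Finset.sum_image hinj]
        exact Finset.sum_congr rfl fun z _ => by rw [sub_add_cancel]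
      rw [← himg]
      have hsub2 : s.image (fun z => z - e μ) ⊆ S := Finset.subset_union_right
      refine Finset.sum_subset hsub2 fun x _ hx => ?_
      have hzero : F (x + e μ) = 0 := by
        refine hFs _ fun hmem => hx ?_
        exact Finset.mem_image.2 ⟨x + e μ, hmem, add_sub_cancel_right x (e μ)⟩
      rw [hzero, fnorm_zero]; ring
    · -- the unshifted part lives on `s`
      refine Finset.sum_subset hsS fun x _ hx => ?_
      rw [hFs x hx, fnorm_zero]; ring
  rw [hK, ← Finset.sum_sub_distrib]
  exact Finset.sum_le_sum fun x _ => re_trace_conj_covDerivFwd_ge τ hτp hτt hτs hU hω F μ x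

end Summed

end Literature.MathematicalPhysics.QuantumFieldTheory.Balaban1983to89.B9Eq323ConjugatedLaplacianFormZd

end
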